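import Summits.AtomisticToContinuum.FouriersLaw.Theses.HonestZwanzig
import Summits.AtomisticToContinuum.FouriersLaw.Theorems.HonestZwanzigNetworkReductionLimits
import Summits.AtomisticToContinuum.FouriersLaw.Theorems.HonestZwanzigGeneratorSiteEnergy
import Summits.AtomisticToContinuum.FouriersLaw.Theorems.HonestZwanzigParityStatics

/-!
# HonestZwanzig / PositiveMemory — the profile form (stub S2 of line `Sketch`)

Support file for item `stmt-AtomisticToContinuum-12694` (`PositiveMemory` of route `HonestZwanzig`,
sub-problem `FouriersLaw`). At fixed `N ≥ 2` and `s > 0`, for a site profile `ζ` vanishing at the two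
contact sites, the quadratic form of the Feshbach matrix
`𝔽(s)_{xy} = s·cov(e_x,e_y) − cov(e_x, L e_y) − schur_s((L e_x)∘Θ, L e_y)` of the route is
`ζᵀ𝔽(s)ζ = s·cov(E_ζ, E_ζ) + schur_s(J_{∇ζ}, J_{∇ζ})`, `E_ζ = Σ_x ζ_x e_x`, `J_{∇ζ} = Σ_b (ζ_{b+1} − ζ_b) j_b`:
(i) `Σ ζ_x ζ_y cov(e_x,e_y) = cov(E_ζ,E_ζ)` (bilinearity of `cov`; products of admissible observables are
`μ_T`-integrable); (ii) `cov(e_x, L e_y) = −γT²[x = y ∈ ∂]` (`ParityStatics`) drops along `ζ`;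
(iii) `Σ_y ζ_y L e_y = J_{∇ζ}` pointwise (`GeneratorSiteEnergy`, summation by parts) and
`J_{∇ζ}∘Θ = −J_{∇ζ}`, whence by linearity of `lap_s` in the first slot and time reversal
`lap_s(f,g) = lap_s(g∘Θ,f∘Θ)` for the second (package `FeshbachIdentities`)
`Σ ζ_x ζ_y schur_s((L e_x)∘Θ, L e_y) = −schur_s(J_{∇ζ}, J_{∇ζ})`.
Layers as in the `NetworkReduction` files: the abstract bookkeeping `profileForm_abstract`, its instance
`fixedN_profileForm` for the canonical objects (gadgets, including `J_{∇ζ}`, as variables with defining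
hypotheses instantiated by `rfl`), and the registered stub `stub_profileForm`.
-/

noncomputable section

open MeasureTheory Finset Real Set Filter Matrix
open Literature.MathematicalPhysics.KineticTheory.HeatConduction
open Summit.AtomisticToContinuum.FouriersLaw.Theorems.HonestZwanzig.NetworkReduction

namespace Summit.AtomisticToContinuum.FouriersLaw.Theorems.HonestZwanzig.PositiveMemory

/-! ### The abstract profile form (pairings at one fixed `s`) -/

/-- **Profile form, abstract version.** With `schur(f,g) = lap(f,g) − Σ lap(f,e_x) G⁻¹_{xy} lap(e_y,g)`
and `𝔽_{xy} = s·cov(e_x,e_y) − cov(e_x, Lf y) − schur(Lr x, Lf y)`: if along the profile `ζ` the static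
terms collapse to `cov(E,E)` and `0` and the dynamic ones to `−lap(J,J)`, `−lap(J,e_u)`, `lap(e_v,J)`,
then `ζᵀ𝔽ζ = s·cov(E,E) + schur(J,J)`. -/
theorem profileForm_abstract {X : Type*} {N : ℕ}
    (lap cov schur : (X → ℝ) → (X → ℝ) → ℝ) (e Lf Lr : Fin N → X → ℝ)
    (G : Matrix (Fin N) (Fin N) ℝ) (F : Fin N → Fin N → ℝ) (s : ℝ)
    (hschur : ∀ f g, schur f g = lap f g - ∑ x, ∑ y, lap f (e x) * G⁻¹ x y * lap (e y) g)
    (hF : ∀ x y, F x y = s * cov (e x) (e y) - cov (e x) (Lf y) - schur (Lr x) (Lf y))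
    (ζ : Fin N → ℝ) (E J : X → ℝ)
    (hcovE : ∑ x, ∑ y, ζ x * cov (e x) (e y) * ζ y = cov E E)
    (hcovL : ∑ x, ∑ y, ζ x * cov (e x) (Lf y) * ζ y = 0)
    (hlap1 : ∑ x, ∑ y, ζ x * lap (Lr x) (Lf y) * ζ y = -lap J J)
    (hlap2 : ∀ u, ∑ x, ζ x * lap (Lr x) (e u) = -lap J (e u))
    (hlap3 : ∀ v, ∑ y, lap (e v) (Lf y) * ζ y = lap (e v) J) :
    ∑ x, ∑ y, ζ x * F x y * ζ y = s * cov E E + schur J J := by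
  -- the `G⁻¹`-sandwich is the matrix triple product `A G⁻¹ B` and collapses along the profile
  have hT : ∑ x, ∑ y, ζ x * (∑ u, ∑ v, lap (Lr x) (e u) * G⁻¹ u v * lap (e v) (Lf y)) * ζ y =
      -∑ u, ∑ v, lap J (e u) * G⁻¹ u v * lap (e v) J := by
    have h1 : ∀ x y, (∑ u, ∑ v, lap (Lr x) (e u) * G⁻¹ u v * lap (e v) (Lf y)) =
        ((Matrix.of fun x u => lap (Lr x) (e u)) * G⁻¹ * (Matrix.of fun v y => lap (e v) (Lf y))) x y :=
      fun x y => by rw [mul_mul_apply_eq_sum_sum]; rfl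
    have h2 : ζ ᵥ* (Matrix.of fun x u => lap (Lr x) (e u)) = -(fun u => lap J (e u)) := by
      funext u
      simp only [vecMul, dotProduct, of_apply, Pi.neg_apply]
      exact hlap2 u
    have h3 : (Matrix.of fun v y => lap (e v) (Lf y)) *ᵥ ζ = fun v => lap (e v) J := by
      funext v
      simp only [mulVec, dotProduct, of_apply]
      exact hlap3 v
    simp_rw [h1]
    rw [sum_sum_eq_dotProduct_mulVec, ← mulVec_mulVec, ← mulVec_mulVec, dotProduct_mulVec, h2, h3,
      neg_dotProduct, sum_sum_eq_dotProduct_mulVec]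
  have hxy : ∀ x y, ζ x * F x y * ζ y = s * (ζ x * cov (e x) (e y) * ζ y) -
      ζ x * cov (e x) (Lf y) * ζ y - ζ x * lap (Lr x) (Lf y) * ζ y +
      ζ x * (∑ u, ∑ v, lap (Lr x) (e u) * G⁻¹ u v * lap (e v) (Lf y)) * ζ y := by
    intro x y
    rw [hF, hschur]
    ring
  rw [Finset.sum_congr rfl fun x _ => Finset.sum_congr rfl fun y _ => hxy x y]
  simp only [Finset.sum_add_distrib, Finset.sum_sub_distrib, ← Finset.mul_sum]
  rw [hcovE, hcovL, hlap1, hT, hschur]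
  ring

/-- Summation by parts bookkeeping: for a profile vanishing at the last site,
`Σ_j [j = b+1](ζ_j − ζ_b) = (Σ_j [j = b+1] ζ_j) − ζ_b` (both are `ζ_{b+1} − ζ_b`, resp. `0` at the last `b`). -/
theorem pf_coeff {N : ℕ} (ζ : Fin N → ℝ) (hζ : ∀ x : Fin N, (x.val = 0 ∨ x.val = N - 1) → ζ x = 0)
    (b : Fin N) :
    (∑ j : Fin N, if j.val = b.val + 1 then ζ j - ζ b else 0) =
      (∑ j : Fin N, if j.val = b.val + 1 then ζ j else 0) - ζ b := by
  by_cases hb : b.val + 1 < N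
  · rw [sum_ite_val_eq (b.val + 1) hb (fun j => ζ j - ζ b), sum_ite_succ_eq ζ b hb]
  · rw [sum_ite_succ_eq_zero ζ b hb, hζ b (Or.inr (by omega)), sub_zero]
    exact Finset.sum_eq_zero fun j _ => if_neg fun h : j.val = b.val + 1 => hb (h ▸ j.isLt)

/-! ### The canonical objects: discharging the hypotheses from `FeshbachIdentities` -/

section Package

variable {ω₂ lam β γ : ℝ} {N : ℕ} {T : ℝ}
  {Adm : (PhaseSpace N → ℝ) → Prop}
  {corr : (PhaseSpace N → ℝ) → (PhaseSpace N → ℝ) → ℝ → ℝ}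
  {lap : ℝ → (PhaseSpace N → ℝ) → (PhaseSpace N → ℝ) → ℝ}
  {cov : (PhaseSpace N → ℝ) → (PhaseSpace N → ℝ) → ℝ}
  {e : Fin N → PhaseSpace N → ℝ}
  (hAdm : ∀ f, Adm f ↔ (Continuous f ∧ ∃ A : ℝ, ∀ z,
    |f z| ≤ A * Real.exp ((pinnedChain ω₂ lam β γ).hamiltonian N z / (8 * T))))
  (hcorr : ∀ f g t, corr f g t =
    (∫ z, f z * (∫ y, g y ∂((pinnedChain ω₂ lam β γ).transitionKernel N T T t.toNNReal z))
      ∂(pinnedChain ω₂ lam β γ).gibbsMeasure N T) -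
    (∫ z, f z ∂(pinnedChain ω₂ lam β γ).gibbsMeasure N T) *
      (∫ z, g z ∂(pinnedChain ω₂ lam β γ).gibbsMeasure N T))
  (hlap : ∀ s f g, lap s f g = ∫ t in Set.Ioi (0 : ℝ), Real.exp (-(s * t)) * corr f g t)
  (hcov : ∀ f g, cov f g = (∫ z, f z * g z ∂(pinnedChain ω₂ lam β γ).gibbsMeasure N T) -
    (∫ z, f z ∂(pinnedChain ω₂ lam β γ).gibbsMeasure N T) *
      (∫ z, g z ∂(pinnedChain ω₂ lam β γ).gibbsMeasure N T))
  (he : ∀ x z, e x z = z.2 x ^ 2 / 2 + (pinnedChain ω₂ lam β γ).U (z.1 x) +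
    ∑ j : Fin N, ((if j.val = x.val + 1 then (pinnedChain ω₂ lam β γ).V (z.1 j - z.1 x) / 2 else 0) +
      (if x.val = j.val + 1 then (pinnedChain ω₂ lam β γ).V (z.1 x - z.1 j) / 2 else 0)))
  (hFI : ∀ f g : PhaseSpace N → ℝ, Adm f → Adm g →
    Integrable f ((pinnedChain ω₂ lam β γ).gibbsMeasure N T) ∧
    (∀ t : ℝ, 0 ≤ t → Integrable (fun z => f z *
      (∫ y, g y ∂((pinnedChain ω₂ lam β γ).transitionKernel N T T t.toNNReal z)))
      ((pinnedChain ω₂ lam β γ).gibbsMeasure N T)) ∧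
    IntegrableOn (corr f g) (Set.Ioi 0) ∧
    (∀ t : ℝ, 0 ≤ t → corr f g t = corr (fun z => g (z.1, -z.2)) (fun z => f (z.1, -z.2)) t) ∧
    (∀ s : ℝ, 0 < s → ∀ x : Fin N,
      s * lap s (e x) g - cov (e x) g =
        lap s (fun z => (pinnedChain ω₂ lam β γ).generator N T T (e x) (z.1, -z.2)) g ∧
      s * lap s f (e x) - cov f (e x) = lap s f ((pinnedChain ω₂ lam β γ).generator N T T (e x))))
  (hGSE : ∀ (x : Fin N) (z : PhaseSpace N), (pinnedChain ω₂ lam β γ).generator N T T (e x) z =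
    (∑ b : Fin N, ((if x.val = b.val + 1 then (pinnedChain ω₂ lam β γ).bondCurrent N b z else 0) -
      (if b = x then (pinnedChain ω₂ lam β γ).bondCurrent N b z else 0))) +
    (if x.val = 0 then (pinnedChain ω₂ lam β γ).γ * (T - z.2 x ^ 2) else 0) +
    (if x.val = N - 1 then (pinnedChain ω₂ lam β γ).γ * (T - z.2 x ^ 2) else 0))
  (hPS : ∀ x y : Fin N, cov (e x) ((pinnedChain ω₂ lam β γ).generator N T T (e y)) =
    -(if x = y ∧ (x.val = 0 ∨ x.val = N - 1) then (pinnedChain ω₂ lam β γ).γ * T ^ 2 else 0))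
  (hω : 0 < ω₂) (hl : 0 ≤ lam) (hβ : 0 ≤ β) (hT : 0 < T)
  (ζ : Fin N → ℝ) (hζ : ∀ x : Fin N, (x.val = 0 ∨ x.val = N - 1) → ζ x = 0)
  {Jζ : PhaseSpace N → ℝ}
  (hJζ : Jζ = fun z => ∑ b : Fin N, (∑ j : Fin N, if j.val = b.val + 1 then ζ j - ζ b else 0) *
    (pinnedChain ω₂ lam β γ).bondCurrent N b z)

/-! #### Static part: bilinearity of the covariance and the contact rows -/

include hAdm hω hl hβ hT in
/-- Products of admissible observables are `μ_T`-integrable (`|fg| ≤ AB·e^{H/(4T)}`, `1/(4T) < 1/T`). -/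
theorem pf_integrable_mul {f g : PhaseSpace N → ℝ} (hf : Adm f) (hg : Adm g) :
    Integrable (fun z => f z * g z) ((pinnedChain ω₂ lam β γ).gibbsMeasure N T) := by
  rw [hAdm] at hf hg
  obtain ⟨hfc, A, hA⟩ := hf
  obtain ⟨hgc, B, hB⟩ := hg
  have hint := pinnedChain_integrable_exp_mul_hamiltonian_gibbsMeasure hω hl hβ γ N hT
    (one_div_lt_one_div_of_lt hT (by linarith) : 1 / (4 * T) < 1 / T)
  refine (hint.const_mul (A * B)).mono' (hfc.mul hgc).aestronglyMeasurable
    (Eventually.of_forall fun z => ?_)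
  rw [Real.norm_eq_abs, abs_mul]
  calc |f z| * |g z| ≤ (A * Real.exp ((pinnedChain ω₂ lam β γ).hamiltonian N z / (8 * T))) *
        (B * Real.exp ((pinnedChain ω₂ lam β γ).hamiltonian N z / (8 * T))) :=
        mul_le_mul (hA z) (hB z) (abs_nonneg _) ((abs_nonneg _).trans (hA z))
    _ = A * B * Real.exp (1 / (4 * T) * (pinnedChain ω₂ lam β γ).hamiltonian N z) := by
        rw [mul_mul_mul_comm, ← Real.exp_add, show (pinnedChain ω₂ lam β γ).hamiltonian N z / (8 * T) +
          (pinnedChain ω₂ lam β γ).hamiltonian N z / (8 * T) =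
            1 / (4 * T) * (pinnedChain ω₂ lam β γ).hamiltonian N z by ring]

include hAdm hcov hFI hω hl hβ hT in
/-- Finite linear combinations in the first slot of `cov`, on admissible observables. -/
theorem pf_cov_sum_left (w : Fin N → ℝ) (fs : Fin N → PhaseSpace N → ℝ) (hfs : ∀ i, Adm (fs i))
    {g : PhaseSpace N → ℝ} (hg : Adm g) :
    cov (fun z => ∑ i, w i * fs i z) g = ∑ i, w i * cov (fs i) g := by
  have hI : ∀ i, Integrable (fs i) ((pinnedChain ω₂ lam β γ).gibbsMeasure N T) :=
    fun i => (hFI (fs i) (fs i) (hfs i) (hfs i)).1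
  have hIg : ∀ i, Integrable (fun z => fs i z * g z) ((pinnedChain ω₂ lam β γ).gibbsMeasure N T) :=
    fun i => pf_integrable_mul hAdm hω hl hβ hT (hfs i) hg
  have h1 : ∫ z, (∑ i, w i * fs i z) * g z ∂(pinnedChain ω₂ lam β γ).gibbsMeasure N T =
      ∑ i, w i * ∫ z, fs i z * g z ∂(pinnedChain ω₂ lam β γ).gibbsMeasure N T := by
    simp_rw [Finset.sum_mul, mul_assoc]
    rw [integral_finsetSum _ fun i _ => (hIg i).const_mul (w i)]
    exact Finset.sum_congr rfl fun i _ => integral_const_mul _ _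
  have h2 : ∫ z, (∑ i, w i * fs i z) ∂(pinnedChain ω₂ lam β γ).gibbsMeasure N T =
      ∑ i, w i * ∫ z, fs i z ∂(pinnedChain ω₂ lam β γ).gibbsMeasure N T := by
    rw [integral_finsetSum _ fun i _ => (hI i).const_mul (w i)]
    exact Finset.sum_congr rfl fun i _ => integral_const_mul _ _
  rw [hcov, h1, h2, Finset.sum_mul, ← Finset.sum_sub_distrib]
  exact Finset.sum_congr rfl fun i _ => by rw [hcov]; ring

include hAdm hcov he hFI hω hl hβ hT in
/-- `ζᵀ Cov(e,e) ζ = cov(E_ζ, E_ζ)` with `E_ζ = Σ_x ζ_x e_x`. -/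
theorem pf_cov_quad :
    ∑ x, ∑ y, ζ x * cov (e x) (e y) * ζ y = cov (fun z => ∑ x, ζ x * e x z) (fun z => ∑ x, ζ x * e x z) := by
  have hex : ∀ x, Adm (e x) := fun x => adm_e Adm hAdm e he hω hl hβ hT x
  have hE : Adm (fun z => ∑ x, ζ x * e x z) :=
    adm_sum Adm hAdm Finset.univ (fun x z => ζ x * e x z) (adm_const Adm hAdm hω hl hβ hT 0)
      fun x _ => adm_const_mul Adm hAdm (ζ x) (hex x)
  rw [pf_cov_sum_left hAdm hcov hFI hω hl hβ hT ζ e hex hE]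
  refine Finset.sum_congr rfl fun x _ => ?_
  rw [cov_comm hcov (e x) (fun z => ∑ y, ζ y * e y z),
    pf_cov_sum_left hAdm hcov hFI hω hl hβ hT ζ e hex (hex x), Finset.mul_sum]
  refine Finset.sum_congr rfl fun y _ => ?_
  rw [cov_comm hcov (e y) (e x)]
  ring

include hPS hζ in
/-- The contact rows `cov(e_x, L e_y) = −γT²[x = y ∈ ∂]` drop along a profile vanishing at the contacts. -/
theorem pf_cov_generator_quad :
    ∑ x, ∑ y, ζ x * cov (e x) ((pinnedChain ω₂ lam β γ).generator N T T (e y)) * ζ y = 0 :=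
  Finset.sum_eq_zero fun x _ => Finset.sum_eq_zero fun y _ => by
    rw [hPS]
    split_ifs with h
    · rw [hζ x h.2]
      ring
    · ring

/-! #### Pointwise: `Σ_y ζ_y L e_y = J_{∇ζ}`, `J_{∇ζ}∘Θ = −J_{∇ζ}` -/

include hGSE hζ hJζ in
/-- `Σ_y ζ_y (L e_y) = J_{∇ζ} = Σ_b (ζ_{b+1} − ζ_b) j_b` for a profile vanishing at the two contact sites
(`GeneratorSiteEnergy`: `L e_y = j_{y−1} − j_y +` bath terms at the contacts; summation by parts). -/
theorem pf_generator_fun :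
    (fun z => ∑ y, ζ y * (pinnedChain ω₂ lam β γ).generator N T T (e y) z) = Jζ := by
  rw [hJζ]
  funext z
  -- the bath terms sit at the contacts, where `ζ` vanishes
  have hb : ∀ (y : Fin N) (c : Prop) [Decidable c], (c → ζ y = 0) →
      ζ y * (if c then (pinnedChain ω₂ lam β γ).γ * (T - z.2 y ^ 2) else 0) = 0 := by
    intro y c _ hc
    by_cases h : c
    · rw [hc h, zero_mul]
    · rw [if_neg h, mul_zero]
  calc ∑ y, ζ y * (pinnedChain ω₂ lam β γ).generator N T T (e y) z
      = ∑ y, ∑ b, (ζ y * (if y.val = b.val + 1 then (pinnedChain ω₂ lam β γ).bondCurrent N b z else 0) -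
          ζ y * (if b = y then (pinnedChain ω₂ lam β γ).bondCurrent N b z else 0)) := by
        refine Finset.sum_congr rfl fun y _ => ?_
        rw [hGSE, mul_add, mul_add, hb y _ fun h => hζ y (Or.inl h), hb y _ fun h => hζ y (Or.inr h),
          add_zero, add_zero, Finset.mul_sum]
        exact Finset.sum_congr rfl fun b _ => mul_sub _ _ _
    _ = ∑ b, ((∑ y : Fin N, if y.val = b.val + 1 then ζ y else 0) - ζ b) *
          (pinnedChain ω₂ lam β γ).bondCurrent N b z := by
        rw [Finset.sum_comm]
        refine Finset.sum_congr rfl fun b _ => ?_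
        simp only [mul_ite, mul_zero, Finset.sum_sub_distrib, Fintype.sum_ite_eq, sub_mul, Finset.sum_mul,
          ite_mul, zero_mul]
    _ = _ := Finset.sum_congr rfl fun b _ => by rw [pf_coeff ζ hζ b]

include hJζ in
/-- The profile current is odd in the momenta: `J_{∇ζ}∘Θ = −J_{∇ζ}`. -/
theorem pf_current_rev : (fun z : PhaseSpace N => Jζ (z.1, -z.2)) = fun z => (-1) * Jζ z := by
  rw [hJζ]
  funext z
  rw [neg_one_mul, ← Finset.sum_neg_distrib]
  exact Finset.sum_congr rfl fun b _ => by rw [OscillatorChain.bondCurrent_neg_momentum]; ring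

include hAdm hω hl hβ hT hJζ in
/-- The profile current is admissible. -/
theorem pf_adm_current : Adm Jζ := by
  rw [hJζ]
  exact adm_sum Adm hAdm Finset.univ
    (fun b z => (∑ j : Fin N, if j.val = b.val + 1 then ζ j - ζ b else 0) *
      (pinnedChain ω₂ lam β γ).bondCurrent N b z) (adm_const Adm hAdm hω hl hβ hT 0)
    fun b _ => adm_const_mul Adm hAdm _ (adm_bondCurrent Adm hAdm hω hl hβ hT b)

/-! #### Dynamic part: the Laplace pairings along the profile -/

include hAdm hcorr hlap hFI hGSE hω hl hβ hT hζ hJζ in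
/-- First slot: `Σ_x ζ_x lap_s((L e_x)∘Θ, g) = −lap_s(J_{∇ζ}, g)` for admissible `g` (linearity of `lap_s`
on admissible observables and `Σ_x ζ_x (L e_x)∘Θ = J_{∇ζ}∘Θ = −J_{∇ζ}`). -/
theorem pf_lap_Lr_sum {s : ℝ} (hs : 0 ≤ s) {g : PhaseSpace N → ℝ} (hg : Adm g) :
    ∑ x, ζ x * lap s (fun z => (pinnedChain ω₂ lam β γ).generator N T T (e x) (z.1, -z.2)) g =
      -lap s Jζ g := by
  have hLr : ∀ x, Adm (fun z => (pinnedChain ω₂ lam β γ).generator N T T (e x) (z.1, -z.2)) :=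
    fun x => adm_rev Adm hAdm (adm_generator_e hAdm hGSE hω hl hβ hT x)
  rw [← lap_sum_left hAdm hcorr hlap hFI hω hl hβ hT Finset.univ ζ
      (fun x z => (pinnedChain ω₂ lam β γ).generator N T T (e x) (z.1, -z.2)) (fun x _ => hLr x) hg hs,
    ← neg_one_mul (lap s Jζ g), ← lap_const_mul_left hcorr hlap, ← pf_current_rev ζ hJζ,
    ← pf_generator_fun hGSE ζ hζ hJζ]

include hAdm hcorr hlap he hFI hGSE hω hl hβ hT hζ hJζ in
/-- Second slot by time reversal: `Σ_y lap_s(e_v, L e_y) ζ_y = lap_s(e_v, J_{∇ζ})`. -/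
theorem pf_lap_e_Lf_sum {s : ℝ} (hs : 0 ≤ s) (v : Fin N) :
    ∑ y, lap s (e v) ((pinnedChain ω₂ lam β γ).generator N T T (e y)) * ζ y = lap s (e v) Jζ := by
  have hex : ∀ x, Adm (e x) := fun x => adm_e Adm hAdm e he hω hl hβ hT x
  have hev : (fun z : PhaseSpace N => e v (z.1, -z.2)) = e v := funext fun z => e_neg_momentum _ e he v z
  rw [lap_rev hlap hFI (hex v) (pf_adm_current hAdm hω hl hβ hT ζ hJζ) s, hev, pf_current_rev ζ hJζ,
    lap_const_mul_left hcorr hlap, neg_one_mul,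
    ← pf_lap_Lr_sum hAdm hcorr hlap hFI hGSE hω hl hβ hT ζ hζ hJζ hs (hex v)]
  refine Finset.sum_congr rfl fun y _ => ?_
  rw [lap_rev hlap hFI (hex v) (adm_generator_e hAdm hGSE hω hl hβ hT y) s, hev, mul_comm]

include hAdm hcorr hlap hFI hGSE hω hl hβ hT hζ hJζ in
/-- Both slots: `Σ_x Σ_y ζ_x lap_s((L e_x)∘Θ, L e_y) ζ_y = −lap_s(J_{∇ζ}, J_{∇ζ})`. -/
theorem pf_lap_Lr_Lf_sum {s : ℝ} (hs : 0 ≤ s) :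
    ∑ x, ∑ y, ζ x * lap s (fun z => (pinnedChain ω₂ lam β γ).generator N T T (e x) (z.1, -z.2))
        ((pinnedChain ω₂ lam β γ).generator N T T (e y)) * ζ y = -lap s Jζ Jζ := by
  have hLf := adm_generator_e hAdm hGSE hω hl hβ hT (e := e)
  have hJ : Adm Jζ := pf_adm_current hAdm hω hl hβ hT ζ hJζ
  rw [Finset.sum_comm, ← pf_lap_Lr_sum hAdm hcorr hlap hFI hGSE hω hl hβ hT ζ hζ hJζ hs hJ]
  refine Finset.sum_congr rfl fun y _ => ?_
  rw [← Finset.sum_mul, pf_lap_Lr_sum hAdm hcorr hlap hFI hGSE hω hl hβ hT ζ hζ hJζ hs (hLf y),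
    lap_rev hlap hFI hJ (hLf y) s, pf_current_rev ζ hJζ, lap_const_mul_right hcorr hlap]
  ring

/-! #### The profile form for the canonical objects -/

include hAdm hcorr hlap hcov hFI he hGSE hPS hω hl hβ hT hζ hJζ in
/-- **The profile form at fixed `N` and `s ≥ 0` for the canonical objects**: for a site profile `ζ`
vanishing at the two contact sites, `ζᵀ𝔽ζ = s·cov(E_ζ, E_ζ) + schur_s(J_{∇ζ}, J_{∇ζ})`. -/
theorem fixedN_profileForm {s : ℝ} (hs : 0 ≤ s)
    (G : Matrix (Fin N) (Fin N) ℝ)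
    (schur : (PhaseSpace N → ℝ) → (PhaseSpace N → ℝ) → ℝ)
    (hschur : ∀ f g, schur f g = lap s f g - ∑ x, ∑ y, lap s f (e x) * G⁻¹ x y * lap s (e y) g)
    (F : Fin N → Fin N → ℝ)
    (hF : ∀ x y, F x y = s * cov (e x) (e y) - cov (e x) ((pinnedChain ω₂ lam β γ).generator N T T (e y)) -
      schur (fun z => (pinnedChain ω₂ lam β γ).generator N T T (e x) (z.1, -z.2))
        ((pinnedChain ω₂ lam β γ).generator N T T (e y))) :
    ∑ x, ∑ y, ζ x * F x y * ζ y =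
      s * cov (fun z => ∑ x, ζ x * e x z) (fun z => ∑ x, ζ x * e x z) + schur Jζ Jζ :=
  profileForm_abstract (lap s) cov schur e (fun y => (pinnedChain ω₂ lam β γ).generator N T T (e y))
    (fun y z => (pinnedChain ω₂ lam β γ).generator N T T (e y) (z.1, -z.2)) G F s hschur hF ζ _ _
    (pf_cov_quad hAdm hcov he hFI hω hl hβ hT ζ) (pf_cov_generator_quad hPS ζ hζ)
    (pf_lap_Lr_Lf_sum hAdm hcorr hlap hFI hGSE hω hl hβ hT ζ hζ hJζ hs)
    (fun u => pf_lap_Lr_sum hAdm hcorr hlap hFI hGSE hω hl hβ hT ζ hζ hJζ hs (adm_e Adm hAdm e he hω hl hβ hT u))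
    (fun v => pf_lap_e_Lf_sum hAdm hcorr hlap he hFI hGSE hω hl hβ hT ζ hζ hJζ hs v)

end Package

/-! ### The registered stub -/

/-- **Stub S2 — the profile form** (fixed `N`, `s > 0`; bilinear bookkeeping over `FeshbachIdentities`,
`GeneratorSiteEnergy`, `ParityStatics`): for a site profile `ζ` vanishing at the two contact sites,
`ζᵀ𝔽(s)ζ = s·cov(E_ζ, E_ζ) + schur_s(J_{∇ζ}, J_{∇ζ})` with `E_ζ = Σ_x ζ_x e_x` and
`J_{∇ζ} = Σ_b (ζ_{b+1} − ζ_b) j_b` (the contact rows of `𝔽` drop, `L E_ζ = J_{∇ζ}`, `J_{∇ζ}∘Θ = −J_{∇ζ}`). -/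
theorem stub_profileForm :
    Summit.AtomisticToContinuum.FouriersLaw.Theses.HonestZwanzig.FeshbachIdentities →
    ∀ ω₂ lam β γ : ℝ, 0 < ω₂ → 0 < lam → 0 < β → 0 < γ → ∀ T : ℝ, 0 < T → ∀ N : ℕ, 2 ≤ N →
    let P := Literature.MathematicalPhysics.KineticTheory.HeatConduction.pinnedChain ω₂ lam β γ;
    let X := Literature.MathematicalPhysics.KineticTheory.HeatConduction.PhaseSpace N;
    let μ : MeasureTheory.Measure X := P.gibbsMeasure N T;
    let corr : (X → ℝ) → (X → ℝ) → ℝ → ℝ := fun f g t =>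
      (∫ z, f z * (∫ y, g y ∂(P.transitionKernel N T T t.toNNReal z)) ∂μ) - (∫ z, f z ∂μ) * (∫ z, g z ∂μ);
    let lap : ℝ → (X → ℝ) → (X → ℝ) → ℝ := fun s f g =>
      ∫ t in Set.Ioi (0 : ℝ), Real.exp (-(s * t)) * corr f g t;
    let cov : (X → ℝ) → (X → ℝ) → ℝ := fun f g => (∫ z, f z * g z ∂μ) - (∫ z, f z ∂μ) * (∫ z, g z ∂μ);
    let e : Fin N → X → ℝ := fun x z => z.2 x ^ 2 / 2 + P.U (z.1 x) +
      ∑ j : Fin N, ((if j.val = x.val + 1 then P.V (z.1 j - z.1 x) / 2 else 0) +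
        (if x.val = j.val + 1 then P.V (z.1 x - z.1 j) / 2 else 0));
    let G : ℝ → Matrix (Fin N) (Fin N) ℝ := fun s => Matrix.of fun x y => lap s (e x) (e y);
    let schur : ℝ → (X → ℝ) → (X → ℝ) → ℝ := fun s f g =>
      lap s f g - ∑ x : Fin N, ∑ y : Fin N, lap s f (e x) * (G s)⁻¹ x y * lap s (e y) g;
    let F : ℝ → Fin N → Fin N → ℝ := fun s x y => s * cov (e x) (e y) - cov (e x) (P.generator N T T (e y)) -
      schur s (fun z => P.generator N T T (e x) (z.1, -z.2)) (P.generator N T T (e y));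
    ∀ s : ℝ, 0 < s → ∀ ζ : Fin N → ℝ, (∀ x : Fin N, (x.val = 0 ∨ x.val = N - 1) → ζ x = 0) →
      (∑ x : Fin N, ∑ y : Fin N, ζ x * F s x y * ζ y) =
        s * cov (fun z => ∑ x : Fin N, ζ x * e x z) (fun z => ∑ x : Fin N, ζ x * e x z) +
          schur s (fun z => ∑ b : Fin N, (∑ j : Fin N, if j.val = b.val + 1 then ζ j - ζ b else 0) * P.bondCurrent N b z)
            (fun z => ∑ b : Fin N, (∑ j : Fin N, if j.val = b.val + 1 then ζ j - ζ b else 0) * P.bondCurrent N b z) := by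
  intro hFI ω₂ lam β γ hω hl hβ hγ T hT N hN
  obtain ⟨-, hFI2, -, -⟩ := hFI ω₂ lam β γ hω hl hβ hγ T hT N hN
  intro P X μ corr lap cov e G schur F s hs ζ hζ
  exact fixedN_profileForm (ω₂ := ω₂) (lam := lam) (β := β) (γ := γ) (N := N) (T := T)
    (fun f => Iff.rfl) (fun f g t => rfl) (fun s f g => rfl) (fun f g => rfl) (fun x z => rfl) hFI2
    (fun x z => generatorSiteEnergy_proof ω₂ lam β γ N hN T T x z)
    (fun x y => ((parityStatics_proof ω₂ lam β γ hω hl hβ hγ T hT N hN) x).2 y)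
    hω hl.le hβ.le hT ζ hζ rfl hs.le (G s) (schur s) (fun f g => rfl) (F s) (fun x y => rfl)

end Summit.AtomisticToContinuum.FouriersLaw.Theorems.HonestZwanzig.PositiveMemory

end
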